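import Summits.ABC.IUTFork.Repair.RHToptLicenceOnlyLowerBound
import HarnessLib

/-!
# D-0121 T-OPTIMALITY, topt-pv-1 — WORKED INSTANCE of the information-model floor at the worked place of record
# (FREY `p = 7`, `l = 107`: `e = 1605`, `m_q = 210`, `δ = 1604`, `r_in = 268`, `r_out = −4472`, `l⋆ = 53`, licensed segment `j ≤ j₀ = 31`)

abc-iut cell, rung LADDER-ABC:A2.RESCUE.H; sequel (PROOF-ONLY, 0 definitions) of `RHToptLicenceOnlyLowerBound.lean` (p489989, §3 `RH.ToptModel`:
«the least `ε` certified from {licence on `σ`, honest cone, certified slack on `σ`} is EXACTLY `T − C_σ`; from {licence, cone} EXACTLY `T`»).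
Here the free real cell model is INSTANTIATED at the ONE worked place of D0121-SPEC v0.2 §1.1′ / R29 / rh3-ref-1 2026-08-27T02:36:02Z (integers
reproduced to the unit by topt-lp-2's prototype and by this seat): ONE place (`V := Unit`), labels `j = i+1 ≤ l⋆ = 53`, trivial mass
`t_j = (j²−1)·m_q = 210·(j²−1)` (place-weight-free integer currency of the referee), certified slack on the licensed segment `σ = {j ≤ 31}`
`s_j = price_j − demand_j` with the SLACK-LAW price of p484618 `RHHullCellSlackLaw` (`price_j = j·δ + (j+1)·G + ρ_j`, `G = r_in − r_out = 4740`,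
`ρ_j = (j²m − jδ − (j+1)r_in) mod e`) spelled out inline, `s = 0` off `σ`.
WHAT IS PROVED (all by evaluation of the 53-term sums; `norm_num` / `decide`, no `native_decide`):
* `slack_nonneg` — `s ≥ 0` (the 31 licensed labels ARE licensed: `price_j ≥ demand_j` for `j ≤ 31`), `cost_nonneg`;
* `offMass_eq` — `Σ_{j=32}^{53} 210·(j²−1) = 8 526 210` (`= T` in integer currency; `M = Σ_{j ≤ 53} = 10 707 060`, `totalMass_eq`; `μ₄ = 1 − T/M =
  0.2037`), `onCredit_eq` — `Σ_{j ≤ 31} (price_j − demand_j) = 1 138 639` (`= C_σ`, R29's worked value);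
* **`floor_eq`** — the model floor `PN Σᶠ 1_{σᶜ}·t − PN Σᶠ 1_σ·s = (8 526 210 − 1 138 639)/53 = 7 387 571/53`, and its two readings through p489989:
  **`certified_iff`** (`ε` is certified by EVERY table consistent with {cone, exact slack on `σ`} ⟺ `7 387 571/53 ≤ ε` — LIC/netting) and
  **`licenceCertified_iff`** (… with {cone, licence on `σ`} only ⟺ `8 526 210/53 ≤ ε` — LIC/none, «c = 1»). Netting gain at this place = `C_σ/M = 0.1063`
  of the mass, exactly the R29 number.
HONEST FRAMING: arithmetic on the integers of ONE tabulated place; the link «integers ↔ datum» is the kit/referee certificate (computed ≠ proved; radii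
audit R33 pending for the EX reading, not used here); nothing here asserts that abc is proved or refuted, or that [IUTchIII] Cor. 3.12 holds or fails at
any datum, or takes a side on any author; typed ≠ proved. [folklore] (finite sums).
-/

noncomputable section

open Set Function Finset

namespace Summit.ABC.IUTFork.Repair.RH.ToptModel.WorkedFrey7L107

open Literature.IUT.LogThetaLattice Summit.ABC.IUTFork.Repair.RH.SigmaLicence Summit.ABC.IUTFork.Repair.RH.ToptModel

/-! ## §1. The integer tables of the worked place (`i = j − 1` runs over `range 53`) -/

/-- The licensed labels ARE licensed: `price_j − demand_j ≥ 0` for `j = 1, …, 31` (integer check of the 31 slacks; price law of p484618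
spelled out: `price_j = j·1604 + (j+1)·4740 + ((j²·210 − j·1604 − (j+1)·268) mod 1605)`, `demand_j = (j²−1)·210`). [folklore] -/
theorem slackZ_nonneg : ∀ i : Fin 53, (i : ℕ) + 1 ≤ 31 →
    (0 : ℤ) ≤ ((i : ℤ) + 1) * 1604 + ((i : ℤ) + 2) * 4740 + (((i : ℤ) + 1) ^ 2 * 210 - ((i : ℤ) + 1) * 1604 - ((i : ℤ) + 2) * 268) % 1605
      - (((i : ℤ) + 1) ^ 2 - 1) * 210 := by
  decide

/-- `T` in integer currency: the off-`σ` trivial mass `Σ_{j=32}^{53} 210·(j²−1) = 8 526 210`. [folklore] -/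
theorem offMassZ_eq : (∑ i ∈ range 53, if i + 1 ≤ 31 then (0 : ℤ) else (((i : ℤ) + 1) ^ 2 - 1) * 210) = 8526210 := by
  decide

/-- `M` in integer currency: `Σ_{j ≤ 53} 210·(j²−1) = 10 707 060` (so `T/M = 8 526 210/10 707 060`, `μ₄ = 1 − T/M = 0.2037`). [folklore] -/
theorem totalMassZ_eq : (∑ i ∈ range 53, (((i : ℤ) + 1) ^ 2 - 1) * 210) = 10707060 := by
  decide

/-- `C_σ` in integer currency: `Σ_{j ≤ 31} (price_j − demand_j) = 1 138 639` (R29's worked value; `C_σ/M = 0.1063`). [folklore] -/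
theorem onCreditZ_eq : (∑ i ∈ range 53, if i + 1 ≤ 31 then
    ((i : ℤ) + 1) * 1604 + ((i : ℤ) + 2) * 4740 + (((i : ℤ) + 1) ^ 2 * 210 - ((i : ℤ) + 1) * 1604 - ((i : ℤ) + 2) * 268) % 1605
      - (((i : ℤ) + 1) ^ 2 - 1) * 210 else 0) = 1138639 := by
  decide

/-- `Π = Σ_{j ≤ 53} price_j = 9 374 578` (the EX/netting corner's `M − Π = 1 332 482`, `π = Π/M = 0.8756` — R29's numbers; recorded, not used below).
[folklore] -/
theorem priceMassZ_eq : (∑ i ∈ range 53,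
    (((i : ℤ) + 1) * 1604 + ((i : ℤ) + 2) * 4740 + (((i : ℤ) + 1) ^ 2 * 210 - ((i : ℤ) + 1) * 1604 - ((i : ℤ) + 2) * 268) % 1605)) = 9374578 := by
  decide

/-! ## §2. The model at the worked place: tables pinned pointwise (any presentation `σ, t, s` with these values) -/

section Model

variable {σ : Set (Fin 53 × Unit)} {t s : Fin 53 × Unit → ℝ}
  (hσ : ∀ c : Fin 53 × Unit, c ∈ σ ↔ (c.1 : ℕ) + 1 ≤ 31)
  (ht : ∀ c : Fin 53 × Unit, t c = (((((c.1 : ℕ) : ℤ) + 1) ^ 2 - 1) * 210 : ℤ))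
  (hs : ∀ c : Fin 53 × Unit, s c = if (c.1 : ℕ) + 1 ≤ 31 then
    (((((c.1 : ℕ) : ℤ) + 1) * 1604 + (((c.1 : ℕ) : ℤ) + 2) * 4740
      + (((((c.1 : ℕ) : ℤ) + 1) ^ 2 * 210 - (((c.1 : ℕ) : ℤ) + 1) * 1604 - (((c.1 : ℕ) : ℤ) + 2) * 268) % 1605)
      - ((((c.1 : ℕ) : ℤ) + 1) ^ 2 - 1) * 210 : ℤ) : ℝ) else 0)

include ht in
/-- The trivial masses are non-negative. [folklore] -/
theorem cost_nonneg (c : Fin 53 × Unit) : 0 ≤ t c := by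
  rw [ht]
  have h0 : (0 : ℤ) ≤ ((c.1 : ℕ) : ℤ) := Int.natCast_nonneg _
  exact_mod_cast (by nlinarith : (0 : ℤ) ≤ ((((c.1 : ℕ) : ℤ) + 1) ^ 2 - 1) * 210)

include hs in
/-- The certified slacks are non-negative (`slackZ_nonneg` on `σ`, `0` off `σ`). [folklore] -/
theorem slack_nonneg (c : Fin 53 × Unit) : 0 ≤ s c := by
  rw [hs]
  split_ifs with h
  · exact_mod_cast slackZ_nonneg c.1 h
  · exact le_rfl

include hσ ht in
/-- Row value of the off-`σ` mass: `Σᶠ_v 1_{σᶜ}·t (i, v) = 0` for `j ≤ 31`, `= 210·(j²−1)` for `j ≥ 32`. [folklore] -/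
theorem row_off (i : Fin 53) :
    ∑ᶠ v : Unit, σᶜ.indicator t (i, v) = if (i : ℕ) + 1 ≤ 31 then (0 : ℝ) else (((((i : ℕ) : ℤ) + 1) ^ 2 - 1) * 210 : ℤ) := by
  rw [finsum_unique]
  by_cases h : (i : ℕ) + 1 ≤ 31
  · have hmem : (i, (default : Unit)) ∈ σ := (hσ _).mpr h
    rw [if_pos h, Set.indicator_of_notMem (Set.notMem_compl_iff.mpr hmem)]
  · have hnm : (i, (default : Unit)) ∉ σ := fun hc => h ((hσ _).mp hc)
    rw [if_neg h, Set.indicator_of_mem (Set.mem_compl hnm), ht]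

include hσ hs in
/-- Row value of the on-`σ` surplus: `Σᶠ_v 1_σ·s (i, v) = price_j − demand_j` for `j ≤ 31`, `= 0` for `j ≥ 32`. [folklore] -/
theorem row_on (i : Fin 53) :
    ∑ᶠ v : Unit, σ.indicator s (i, v) = if (i : ℕ) + 1 ≤ 31 then
      (((((i : ℕ) : ℤ) + 1) * 1604 + (((i : ℕ) : ℤ) + 2) * 4740
        + (((((i : ℕ) : ℤ) + 1) ^ 2 * 210 - (((i : ℕ) : ℤ) + 1) * 1604 - (((i : ℕ) : ℤ) + 2) * 268) % 1605)
        - ((((i : ℕ) : ℤ) + 1) ^ 2 - 1) * 210 : ℤ) : ℝ) else 0 := by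
  rw [finsum_unique]
  by_cases h : (i : ℕ) + 1 ≤ 31
  · have hmem : (i, (default : Unit)) ∈ σ := (hσ _).mpr h
    rw [if_pos h, Set.indicator_of_mem hmem, hs, if_pos h]
  · have hnm : (i, (default : Unit)) ∉ σ := fun hc => h ((hσ _).mp hc)
    rw [if_neg h, Set.indicator_of_notMem hnm]

include hσ ht in
/-- `Σ_i Σᶠ_v 1_{σᶜ}·t = 8 526 210` (= `T` before procession normalisation). [folklore] -/
theorem sum_off_eq : ∑ i : Fin 53, ∑ᶠ v : Unit, σᶜ.indicator t (i, v) = 8526210 := by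
  simp_rw [row_off hσ ht]
  rw [Fin.sum_univ_eq_sum_range
    (fun i : ℕ => if i + 1 ≤ 31 then (0 : ℝ) else ((((i : ℤ) + 1) ^ 2 - 1) * 210 : ℤ)) 53]
  exact_mod_cast offMassZ_eq

include hσ hs in
/-- `Σ_i Σᶠ_v 1_σ·s = 1 138 639` (= `C_σ` before procession normalisation). [folklore] -/
theorem sum_on_eq : ∑ i : Fin 53, ∑ᶠ v : Unit, σ.indicator s (i, v) = 1138639 := by
  simp_rw [row_on hσ hs]
  rw [Fin.sum_univ_eq_sum_range
    (fun i : ℕ => if i + 1 ≤ 31 then ((((i : ℤ) + 1) * 1604 + ((i : ℤ) + 2) * 4740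
      + ((((i : ℤ) + 1) ^ 2 * 210 - ((i : ℤ) + 1) * 1604 - ((i : ℤ) + 2) * 268) % 1605)
      - (((i : ℤ) + 1) ^ 2 - 1) * 210 : ℤ) : ℝ) else 0) 53]
  exact_mod_cast onCreditZ_eq

include hσ ht in
/-- **`T` at the worked place**: `PN Σᶠ 1_{σᶜ}·t = 8 526 210/53`. [folklore] -/
theorem offMass_eq : processionNormalized (fun i : Fin 53 => ∑ᶠ v : Unit, σᶜ.indicator t (i, v)) = 8526210 / 53 := by
  unfold processionNormalized
  rw [sum_off_eq hσ ht]
  norm_num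

include hσ hs in
/-- **`C_σ` at the worked place**: `PN Σᶠ 1_σ·s = 1 138 639/53`. [folklore] -/
theorem onCredit_eq : processionNormalized (fun i : Fin 53 => ∑ᶠ v : Unit, σ.indicator s (i, v)) = 1138639 / 53 := by
  unfold processionNormalized
  rw [sum_on_eq hσ hs]
  norm_num

include hσ ht hs in
/-- **THE FLOOR at the worked place**: `PN Σᶠ 1_{σᶜ}·t − PN Σᶠ 1_σ·s = (8 526 210 − 1 138 639)/53 = 7 387 571/53`. [folklore] -/
theorem floor_eq : processionNormalized (fun i : Fin 53 => ∑ᶠ v : Unit, σᶜ.indicator t (i, v)) -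
    processionNormalized (fun i : Fin 53 => ∑ᶠ v : Unit, σ.indicator s (i, v)) = 7387571 / 53 := by
  rw [offMass_eq hσ ht, onCredit_eq hσ hs]
  norm_num

include hσ ht hs in
/-- **LIC/netting at the worked place (p489989 `sub_le_iff_forall_consistent` instantiated)**: an `ε` is certified by EVERY deficit table consistent
with {honest cone `d ≤ t`, exact slack `d = −s` on the licensed segment `j ≤ 31`} iff `7 387 571/53 ≤ ε`. [folklore] -/
theorem certified_iff (ε : ℝ) : 7387571 / 53 ≤ ε ↔
    ∀ d : Fin 53 × Unit → ℝ, (∀ i : Fin 53, (Function.support fun v : Unit => d (i, v)).Finite) →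
      (∀ c, d c ≤ t c) → (∀ c ∈ σ, d c = -s c) →
        processionNormalized (fun i : Fin 53 => ∑ᶠ v : Unit, d (i, v)) ≤ ε := by
  rw [← floor_eq hσ ht hs]
  exact sub_le_iff_forall_consistent σ (cost_nonneg ht) (slack_nonneg hs) (fun _ => Set.toFinite _) (fun _ => Set.toFinite _) ε

include hσ ht in
/-- **LIC/none at the worked place («c = 1»; p489989 `le_iff_forall_licenceConsistent` instantiated)**: an `ε` is certified by EVERY deficit table
consistent with {honest cone `d ≤ t`, licence `d ≤ 0` on the segment `j ≤ 31`} iff `8 526 210/53 ≤ ε` — the whole off-slice mass `T`. [folklore] -/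
theorem licenceCertified_iff (ε : ℝ) : 8526210 / 53 ≤ ε ↔
    ∀ d : Fin 53 × Unit → ℝ, (∀ i : Fin 53, (Function.support fun v : Unit => d (i, v)).Finite) →
      (∀ c, d c ≤ t c) → (∀ c ∈ σ, d c ≤ 0) →
        processionNormalized (fun i : Fin 53 => ∑ᶠ v : Unit, d (i, v)) ≤ ε := by
  rw [← offMass_eq hσ ht]
  exact le_iff_forall_licenceConsistent σ (cost_nonneg ht) (fun _ => Set.toFinite _) ε

end Model

end Summit.ABC.IUTFork.Repair.RH.ToptModel.WorkedFrey7L107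

end
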